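import Summits.CriticalPhenomena.SAWScalingLimit.Theorems.SAWDefectDecoherencePolygonParitySqueezeDefs
import Summits.CriticalPhenomena.SAWScalingLimit.Theorems.SAWDefectDecoherenceBoundaryClosureRGateTraceReduction
import Summits.CriticalPhenomena.SAWScalingLimit.Theorems.SAWDefectDecoherenceBoundaryClosureRHolomorphicWeakLimits
import Summits.CriticalPhenomena.SAWScalingLimit.Theorems.SAWDefectDecoherenceBoundaryClosureRGateTraceGateBall
import Summits.CriticalPhenomena.SAWScalingLimit.Theorems.SAWDefectDecoherenceBoundaryClosureRGateTraceFlatArc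
import Summits.CriticalPhenomena.SAWScalingLimit.Theorems.SAWDefectDecoherenceBoundaryClosureRGateTraceGreen
import HarnessLib

/-!
# Gate trace from gate data (crux `BoundaryClosureR`, stmt-CriticalPhenomena-14004, line
# `polygon-parity-squeeze`, registered stub `stub_gateTrace`, mechanism (C))

`stub_gateTrace : GateData → GateL1Root → DefectDecoherence → MassRatio → GateTraceH`.  THIS FILE
proves it (`gateTrace_of_gateDbarLimit`, registered sub-goal) from ONE lattice → continuum limit,
**`GateDbarLimit`** = the antecedent of `gateTrace_of_gateDbarLimit` (vocabulary of
`…PolygonParitySqueezeDefs`, nothing new defined): for an admissible family pinned at the root with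
`2ρ < |pt 0 − pt 1|`, `DefectDecoherence`, the gate profile law and the gate layer budget on
`B(pt 1, ρ/4)`, every frame `(Φ, L, L_b)` with a continuous gate extension `L̄`, and every smooth `φ`
supported in `B(pt 1, ρ/4)`:
  `N_δ(∂̄φ) → −i√3 · ∫ φ(x + i·im pt 1) exp((5/8)(L̄(x + i·im pt 1) − L_b)) dx`   as `δ → 0⁺`.
WHY (not formalised here): DCS Lemma 1 summed against the weight `φ(δ c_v)` over `S = Λ δ`
(`Engine.pickEngine_starRegrouping` + `Dressed.satisfiesVertexRelations_observable`): interior edges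
give `−(δ/6) Σ ∂̄φ F − (δ/2) Σ ∂φ (c_w−c_v)² F + O(δ³ Σ|F|)`; the boundary darts in the pinned ball are
the floor edges of row `m δ` (`GateMass.boundaryWindow_eq_image`), all with `mid − c_v = −i/(2√3)`
and `F(e)/F(b δ) = Z(e)/Z(b δ) > 0` (`BoundaryExactness.straightGate` + `boundaryPhaseLaw`), so the
dart sum tends to `−i/(2√3) ∫ φ dλ` by `GateProfileAt`; the twisted `∂φ`-term is `→ 0` by
`DefectDecoherence` at the up faces of row `m δ + k`, `k ≥ 1` (lattice ball of radius `≍ k` inside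
`Λ δ`) plus `GateLayerBudgetAt` (`δ Σ_{k ≤ ρ/δ} k^{−θ}(k+1)^{3/4} → 0` as `θ > 3/4`; row `k = 0`
costs `O(δ)`), and all Taylor remainders are `O(δ^{1/4})` by the budget alone.  (`MassRatio` is not
used: holomorphy of `g` is a hypothesis of `HasGateTrace`.)
HOW THE STUB FOLLOWS (all proved, this file and `…GateTraceGateBall/FlatArc/Green`): shrink `ρ` off
the root; weak-* limit of `N_δ` on a FULL small gate ball (`LocalL1.pickEngine_weakStarLimit`, fed by
`gateTrace_l1Bound_gateBall`); it is `g dA` above the gate, `0` below, and pairs `∂̄φ` as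
`GateDbarLimit` says, i.e. (Green, `gateTrace_green_halfPlane`) as the area pairing with
`2√3 e^{(5/8)(L̄ − L_b)}`; flat-arc uniqueness (`gateTrace_flatArc_eqOn`) gives `g = 2√3 e^{(5/8)(L − L_b)}`
near every gate point of a small gate ball — the trace with the UNIVERSAL constant `c = 2√3` — and
`Identification.identification_of_gateTrace_core` spreads it to every gate point.
-/

noncomputable section

open scoped BigOperators Topology ContDiff
open Filter Set Metric MeasureTheory Complex
open Literature.Probability.LatticeModels Literature.Probability.RandomPlanarGeometry
open Literature.Probability.RandomPlanarGeometry.SAW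
open Literature.Analysis.Complex (dbarAlong dbarAlong_eq_zero_of_notMem_tsupport
  hasCompactSupport_dbarAlong_one tsupport_dbarAlong_one_subset)
open Summit.CriticalPhenomena.SAWScalingLimit.Theses.SAWDefectDecoherence
open Summit.CriticalPhenomena.SAWScalingLimit.Theorems.PickHalfPlane

namespace Summit.CriticalPhenomena.SAWScalingLimit.Theorems.PolygonParitySqueeze

/-! ### The local identification at a gate point, and the stub from `GateDbarLimit` -/

/-- **Local identification near a gate point (the heart of mechanism (C)).**  Data: an admissible
family pinned at the root with disjoint pinned balls (radius `ρ`), the gate profile law and layer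
budget on `B(pt 1, ρ/4)`, the `L¹` law on compacts of `Ω ∪ gate` off the root, `DefectDecoherence`,
the lattice limit `GateDbarLimit` (hypothesis `hGDL`, see the module docstring), a conformal frame
`(Φ, L, L_b)` with its continuous gate extension `L̄`, a mesh sequence and a weak limit `g`
holomorphic on the carrier; plus the two landed analytic inputs `GateTrace.gateTrace_flatArc_eqOn`
and `GateTrace.gateTrace_green_halfPlane`.  Conclusion:
at every gate point `y` of `B(pt 1, ρ/16)`, `g = 2√3 · exp((5/8)(L̄ − L_b))` on `Ω ∩ B(y, ρ/64)`.
Proof: weak-* limit of `N_δ` on the full ball `B(y, ρ/16)` (`LocalL1.pickEngine_weakStarLimit` fed by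
`l1Bound_gateBall`); it is `g dA` above the gate (uniqueness of limits), `0` below
(`eventually_NF_eq_zero_of_below`), and pairs `∂̄φ` as `GateDbarLimit` dictates, which Green's
formula rewrites as the area pairing with the candidate; flat-arc uniqueness concludes. [folklore] -/
theorem eqOn_candidate_near_gate
    {D : DobrushinDomain} {ρ : ℝ} {Λ : ℝ → Finset HexVertex} {m : ℝ → ℤ} {b : ℝ → Sym2 HexVertex}
    (hAF : AdmissibleFamily D ρ Λ m b) {a : ℝ → Sym2 HexVertex} {r₀ : ℝ} {m₀ : ℝ → ℤ}
    (hPR : PinnedFlatRoot D Λ b (D.pt 0) a r₀ m₀) (hρd : 2 * ρ < dist (D.pt 0) (D.pt 1))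
    (hGP : GateProfileAt D ρ (ρ / 4) Λ a b)
    (hL1 : ∀ K : Set ℂ, IsCompact K → K ⊆ D.carrier ∪ gateSeg D ρ → D.pt 0 ∉ K → L1BoundOn Λ a b K)
    {Φ : ConformalEquiv D.carrier UpperHalfPlane.upperHalfPlaneSet} {L : ℂ → ℂ} {Lb : ℂ}
    (hfr : ConformalFrame D Φ L Lb) {Lbar : ℂ → ℂ} (hLbar : ContinuousOn Lbar (D.carrier ∪ gateSeg D ρ))
    (hLbarL : EqOn Lbar L D.carrier)
    (hGDL : ∀ φ : ℂ → ℂ, ContDiff ℝ ∞ φ → HasCompactSupport φ → tsupport φ ⊆ ball (D.pt 1) (ρ / 4) →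
      Tendsto (fun δ : ℝ => NF Λ a b δ (dbarAlong 1 φ)) (𝓝[>] 0)
        (𝓝 (-(Complex.I * (Real.sqrt 3 : ℂ)) *
          ∫ x in Set.Ioo ((D.pt 1).re - ρ / 4) ((D.pt 1).re + ρ / 4),
            φ ((x : ℂ) + ((D.pt 1).im : ℂ) * Complex.I) *
              Complex.exp ((5 / 8 : ℂ) * (Lbar ((x : ℂ) + ((D.pt 1).im : ℂ) * Complex.I) - Lb)))))
    {ns : ℕ → ℝ} (hns : Tendsto ns atTop (𝓝[>] 0)) {g : ℂ → ℂ} (hg : DifferentiableOn ℂ g D.carrier)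
    (hweak : IsWeakLimit D Λ a b ns g) {y : ℂ} (hyim : y.im = (D.pt 1).im)
    (hyb : y ∈ ball (D.pt 1) (ρ / 16)) :
    EqOn g (fun z => (((2 * Real.sqrt 3 : ℝ)) : ℂ) * Complex.exp ((5 / 8 : ℂ) * (Lbar z - Lb)))
      (D.carrier ∩ ball y (ρ / 64)) := by
  have hρ : 0 < ρ := hAF.1
  have hflat := hAF.2.1
  set r : ℝ := ρ / 16 with hrdef
  have hr : 0 < r := by positivity
  set c : ℂ := (((2 * Real.sqrt 3 : ℝ)) : ℂ) with hcdef
  set gs : ℂ → ℂ := fun z => c * Complex.exp ((5 / 8 : ℂ) * (Lbar z - Lb)) with hgsdef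
  ---------------------------------------------------------------- geometry of the small ball
  have hballsub : ball y r ⊆ ball (D.pt 1) (ρ / 8) := fun z hz => by
    rw [mem_ball] at hz hyb ⊢
    linarith [dist_triangle z y (D.pt 1)]
  have hflaty : D.carrier ∩ ball y r = {z : ℂ | y.im < z.im} ∩ ball y r :=
    Engine.flat_of_subset hflat hyim (hballsub.trans (ball_subset_ball (by linarith)))
  ---------------------------------------------------------------- the candidate near the gate
  have hLd : DifferentiableOn ℂ L D.carrier :=
    Literature.NumberTheory.Transcendental.ExpDominant.differentiableOn_of_exp_eq D.isOpen hfr.2.2.1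
      ((Φ.differentiableOn.analyticOnNhd D.isOpen).deriv).differentiableOn hfr.2.2.2.1
  have hgsd : DifferentiableOn ℂ gs ({z : ℂ | y.im < z.im} ∩ ball y r) := by
    rw [← hflaty]
    have h1 : DifferentiableOn ℂ Lbar D.carrier := hLd.congr hLbarL
    exact ((((h1.sub (differentiableOn_const Lb)).const_mul (5 / 8 : ℂ)).cexp).const_mul c).mono
      inter_subset_left
  have hsubU : {z : ℂ | y.im ≤ z.im} ∩ ball y r ⊆ D.carrier ∪ gateSeg D ρ := by
    rintro z ⟨hz, hzb⟩
    rcases (show y.im ≤ z.im from hz).lt_or_eq with hlt | heq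
    · left
      have : z ∈ {z : ℂ | y.im < z.im} ∩ ball y r := ⟨hlt, hzb⟩
      rw [← hflaty] at this
      exact this.1
    · right
      exact ⟨by show z.im = (D.pt 1).im; rw [← heq, hyim], ball_subset_ball (by linarith) (hballsub hzb)⟩
  have hgsc : ContinuousOn gs ({z : ℂ | y.im ≤ z.im} ∩ ball y r) := by
    have h1 : ContinuousOn Lbar ({z : ℂ | y.im ≤ z.im} ∩ ball y r) := hLbar.mono hsubU
    exact continuousOn_const.mul ((continuousOn_const.mul (h1.sub continuousOn_const)).cexp)
  ---------------------------------------------------------------- the weak-* limit on the full ball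
  have hU1 : ∀ K : Set ℂ, IsCompact K → K ⊆ ball y r → ∃ C : ℝ, ∀ᶠ δ : ℝ in 𝓝[>] 0,
      δ ^ 2 * (∑ᶠ z ∈ {z : Sym2 HexVertex | z ∈ hexDomainMidEdges (Λ δ) ∧
          (δ : ℂ) * hexMidpoint z ∈ K},
        ‖hexParafermionicObservable (Λ δ) (a δ) hexCriticalFugacity (5 / 8) z‖) ≤
      C * ‖hexParafermionicObservable (Λ δ) (a δ) hexCriticalFugacity (5 / 8) (b δ)‖ :=
    fun K hK hKU => l1Bound_gateBall hAF hPR hρd hGP hL1 Φ L Lb hfr Lbar hLbar hLbarL K hK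
      (hKU.trans hballsub)
  obtain ⟨ms, hms, Lf, hconv, -, -, -, hrep⟩ :=
    LocalL1.pickEngine_weakStarLimit Λ a b (ball y r) isOpen_ball hU1 ns hns
  have hns' : Tendsto (ns ∘ ms) atTop (𝓝[>] 0) := hns.comp hms.tendsto_atTop
  ---------------------------------------------------------------- (a) above the gate: `Lf = ∫ · g`
  have hLg : ∀ ψ : C(ℂ, ℂ), HasCompactSupport ψ → tsupport ψ ⊆ D.carrier ∩ ball y r →
      Lf ψ = ∫ z, ψ z * g z := by
    intro ψ hψc hψs
    have h1 := hconv ψ hψc (hψs.trans inter_subset_right)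
    have h2 : Tendsto (fun n => NF Λ a b ((ns ∘ ms) n) ψ) atTop (𝓝 (∫ z, ψ z * g z)) :=
      (hweak ψ ⟨ψ.continuous, hψc, hψs.trans inter_subset_left⟩).comp hms.tendsto_atTop
    exact tendsto_nhds_unique h1 h2
  ---------------------------------------------------------------- (b) below the gate: `Lf = 0`
  have hL0 : ∀ ψ : C(ℂ, ℂ), HasCompactSupport ψ → tsupport ψ ⊆ {z : ℂ | z.im < y.im} ∩ ball y r →
      Lf ψ = 0 := by
    intro ψ hψc hψs
    have h1 := hconv ψ hψc (hψs.trans inter_subset_right)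
    have hψs' : tsupport ψ ⊆ {z : ℂ | z.im < (D.pt 1).im} ∩ ball (D.pt 1) (ρ / 2) := by
      refine hψs.trans (inter_subset_inter (fun z hz => ?_) (hballsub.trans (ball_subset_ball ?_)))
      · rw [← hyim]; exact hz
      · linarith
    have hev := hns'.eventually (eventually_NF_eq_zero_of_below hAF a hψc hψs')
    have h2 : Tendsto (fun n => NF Λ a b ((ns ∘ ms) n) ψ) atTop (𝓝 0) :=
      tendsto_const_nhds.congr' (hev.mono fun n hn => hn.symm)
    exact tendsto_nhds_unique h1 h2
  ---------------------------------------------------------------- (c) the gate pairing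
  have hLgate : ∀ φ : ℂ → ℂ, ContDiff ℝ ∞ φ → HasCompactSupport φ → tsupport φ ⊆ ball y r →
      ∀ Φ' : C(ℂ, ℂ), (⇑Φ' = dbarAlong 1 φ) →
        Lf Φ' = ∫ z in {z : ℂ | y.im < z.im}, dbarAlong 1 φ z * gs z := by
    intro φ hφ hφc hφs Φ' hΦ'
    have hΦ'c : HasCompactSupport Φ' := by rw [hΦ']; exact hasCompactSupport_dbarAlong_one hφc
    have hΦ's : tsupport (Φ' : ℂ → ℂ) ⊆ ball y r := by
      rw [hΦ']; exact (tsupport_dbarAlong_one_subset φ).trans hφs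
    have h1 := hconv Φ' hΦ'c hΦ's
    have hφs4 : tsupport φ ⊆ ball (D.pt 1) (ρ / 4) :=
      hφs.trans (hballsub.trans (ball_subset_ball (by linarith)))
    have h2 := (hGDL φ hφ hφc hφs4).comp hns'
    rw [← hΦ'] at h2
    have hlim := tendsto_nhds_unique h1 h2
    rw [hlim]
    -- the candidate side: Green's formula on the half-ball
    have hG := GateTrace.gateTrace_green_halfPlane gs φ y.im (ball y r) isOpen_ball hgsd hgsc (hφ.of_le (by exact_mod_cast le_top)) hφc hφs
    rw [hG, hyim]
    -- the boundary integral: constants and the support window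
    have hwin : ∫ x : ℝ, φ ((x : ℂ) + ((D.pt 1).im : ℂ) * I) * gs ((x : ℂ) + ((D.pt 1).im : ℂ) * I) =
        c * ∫ x in Set.Ioo ((D.pt 1).re - ρ / 4) ((D.pt 1).re + ρ / 4),
          φ ((x : ℂ) + ((D.pt 1).im : ℂ) * I) *
            Complex.exp ((5 / 8 : ℂ) * (Lbar ((x : ℂ) + ((D.pt 1).im : ℂ) * I) - Lb)) := by
      have hstep : ∫ x : ℝ, φ ((x : ℂ) + ((D.pt 1).im : ℂ) * I) * gs ((x : ℂ) + ((D.pt 1).im : ℂ) * I) =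
          ∫ x in Set.Ioo ((D.pt 1).re - ρ / 4) ((D.pt 1).re + ρ / 4),
            φ ((x : ℂ) + ((D.pt 1).im : ℂ) * I) * gs ((x : ℂ) + ((D.pt 1).im : ℂ) * I) := by
        refine (setIntegral_eq_integral_of_forall_compl_eq_zero
          (s := Set.Ioo ((D.pt 1).re - ρ / 4) ((D.pt 1).re + ρ / 4)) fun x hx => ?_).symm
        have hout : (x : ℂ) + ((D.pt 1).im : ℂ) * I ∉ tsupport φ := fun hmem => hx ?_
        · rw [image_eq_zero_of_notMem_tsupport hout, zero_mul]
        have hb := mem_ball.1 (hφs4 hmem)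
        have hre : |x - (D.pt 1).re| < ρ / 4 := by
          refine lt_of_le_of_lt ?_ hb
          have := Complex.abs_re_le_norm ((x : ℂ) + ((D.pt 1).im : ℂ) * I - D.pt 1)
          rw [dist_eq_norm]
          simpa using this
        rw [abs_lt] at hre
        exact ⟨by linarith, by linarith⟩
      rw [hstep, ← integral_const_mul]
      refine integral_congr_ae (Eventually.of_forall fun x => ?_)
      simp only [hgsdef]
      ring
    rw [hwin, hcdef]
    push_cast
    ring
  ---------------------------------------------------------------- flat-arc uniqueness
  have hrep' : ∃ Λb : BoundedContinuousFunction ℂ ℂ →L[ℂ] ℂ, ∀ f : BoundedContinuousFunction ℂ ℂ,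
      tsupport f ⊆ closedBall y (3 * (r / 4)) → Λb f = Lf f.toContinuousMap :=
    hrep (closedBall y (3 * (r / 4))) (isCompact_closedBall _ _) (closedBall_subset_ball (by linarith))
  have key := GateTrace.gateTrace_flatArc_eqOn D.carrier y r hr hflaty g gs (hg.continuousOn.mono inter_subset_left) hgsc Lf
    hrep' hLg hL0 hLgate
  have e64 : ρ / 64 = r / 4 := by rw [hrdef]; ring
  rw [e64]
  exact key

/-- **`GateDbarLimit → stub_gateTrace` (registered sub-goal `gateTrace_of_gateDbarLimit`; mechanism
(C) assembled).**  Hypothesis = `GateDbarLimit` (the ONE missing lattice → continuum limit, see the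
module docstring); conclusion = the registered header of `stub_gateTrace` VERBATIM, with the universal
constant `c = 2√3`.  Proof:
shrink the gate radius to `ρ' = min ρ (|pt 0 − pt 1|/3)`; `eqOn_candidate_near_gate` at every gate
point of `B(pt 1, ρ'/16)` gives the trace `2√3` there; `identification_of_gateTrace_core` identifies
`g = 2√3 · exp((5/8)(L − L_b))` on the whole carrier, whence the trace at every gate point of the
original ball. [folklore] -/
theorem gateTrace_of_gateDbarLimit : (∀ (D : DobrushinDomain) (ρ : ℝ) (Λ : ℝ → Finset HexVertex) (m : ℝ → ℤ) (b : ℝ → Sym2 HexVertex), AdmissibleFamily D ρ Λ m b → ∀ (a : ℝ → Sym2 HexVertex) (r₀ : ℝ) (m₀ : ℝ → ℤ), PinnedFlatRoot D Λ b (D.pt 0) a r₀ m₀ → 2 * ρ < dist (D.pt 0) (D.pt 1) → DefectDecoherence → GateProfileAt D ρ (ρ / 4) Λ a b → GateLayerBudgetAt D (ρ / 4) Λ m a b → ∀ (Φ : ConformalEquiv D.carrier UpperHalfPlane.upperHalfPlaneSet) (L : ℂ → ℂ) (Lb : ℂ), ConformalFrame D Φ L Lb → ∀ (Lbar : ℂ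 → ℂ), ContinuousOn Lbar (D.carrier ∪ gateSeg D ρ) → Set.EqOn Lbar L D.carrier → ∀ (φ : ℂ → ℂ), ContDiff ℝ ∞ φ → HasCompactSupport φ → tsupport φ ⊆ Metric.ball (D.pt 1) (ρ / 4) → Filter.Tendsto (fun δ : ℝ => NF Λ a b δ (Literature.Analysis.Complex.dbarAlong 1 φ)) (𝓝[>] 0) (𝓝 (-(Complex.I * (Real.sqrt 3 : ℂ)) * ∫ x in Set.Ioo ((D.pt 1).re - ρ / 4) ((D.pt 1).re + ρ / 4), φ ((x : ℂ) + ((D.pt 1).im : ℂ) * Complex.I) * Complex.exp ((5 / 8 : ℂ) * (Lbar ((x : ℂ) + ((D.pt 1).im : ℂ) * Complex.I) - Lb))))) → (∀ (D : DobrushinDomain) (ρ : ℝ) (Λ : ℝ → Finset HexVertex) (m : ℝ → ℤ) (b : ℝ → Sym2 HexVertex), AdmissibleFamily D ρ Λ m b → ∀ (a : ℝ → Sym2 HexVertex) (r₀ : ℝ) (m₀ : ℝ → ℤ), PinnedFlatRoot D Λ b (D.pt 0) a r₀ m₀ → 2 * ρ < dist (D.pt 0) (D.pt 1) → GateProfileAt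 D ρ (ρ / 4) Λ a b ∧ GateLayerBudgetAt D (ρ / 4) Λ m a b) → (∀ (D : DobrushinDomain) (ρ : ℝ) (Λ : ℝ → Finset HexVertex) (m : ℝ → ℤ) (b : ℝ → Sym2 HexVertex), AdmissibleFamily D ρ Λ m b → ∀ (a : ℝ → Sym2 HexVertex) (r₀ : ℝ) (m₀ : ℝ → ℤ), PinnedFlatRoot D Λ b (D.pt 0) a r₀ m₀ → ∀ K : Set ℂ, IsCompact K → K ⊆ D.carrier ∪ gateSeg D ρ → D.pt 0 ∉ K → L1BoundOn Λ a b K) → DefectDecoherence → MassRatio → ∃ c : ℂ, c ≠ 0 ∧ ∀ (D : DobrushinDomain) (ρ : ℝ) (Λ : ℝ → Finset HexVertex) (m : ℝ → ℤ) (b : ℝ → Sym2 HexVertex), AdmissibleFamily D ρ Λ m b → ∀ (a : ℝ → Sym2 HexVertex) (r₀ : ℝ) (m₀ : ℝ → ℤ), PinnedFlatRoot D Λ b (D.pt 0) a r₀ m₀ → HasGateTrace c D ρ Λ a b := by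
  intro hGDL hGD hL1R hDD _
  have hc : (((2 * Real.sqrt 3 : ℝ)) : ℂ) ≠ 0 := by
    exact_mod_cast (by positivity : (2 * Real.sqrt 3 : ℝ) ≠ 0)
  refine ⟨(((2 * Real.sqrt 3 : ℝ)) : ℂ), hc, ?_⟩
  intro D ρ Λ m b hAF a r₀ m₀ hPR Φ L Lb hΦ0 hΦb hL hexpL hLb ns hns g hg hweak y _ _
  ---------------------------------------------------------------- shrink the gate radius off the root
  have h01 : D.pt 0 ≠ D.pt 1 := fun h => absurd (D.pt_injective h) (by decide)
  have hd : 0 < dist (D.pt 0) (D.pt 1) := dist_pos.2 h01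
  set ρ' : ℝ := min ρ (dist (D.pt 0) (D.pt 1) / 3) with hρ'def
  have hρ'pos : 0 < ρ' := lt_min hAF.1 (by positivity)
  have hρ'le : ρ' ≤ ρ := min_le_left _ _
  have h2ρ' : 2 * ρ' < dist (D.pt 0) (D.pt 1) := by
    have := min_le_right ρ (dist (D.pt 0) (D.pt 1) / 3); linarith
  have hAF' : AdmissibleFamily D ρ' Λ m b := by
    obtain ⟨_, hflat, hadm, hexh, hb⟩ := hAF
    refine ⟨hρ'pos, Engine.flat_of_subset hflat rfl (ball_subset_ball hρ'le), ?_, hexh, hb⟩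
    filter_upwards [hadm] with δ hδ
    exact ⟨hδ.1, hδ.2.1, hδ.2.2.1, hδ.2.2.2.1, fun v hv => hδ.2.2.2.2 v (ball_subset_ball hρ'le hv)⟩
  obtain ⟨hGP, hGLB⟩ := hGD D ρ' Λ m b hAF' a r₀ m₀ hPR h2ρ'
  have hL1' := hL1R D ρ' Λ m b hAF' a r₀ m₀ hPR
  have hflat' := hAF'.2.1
  have hfr : ConformalFrame D Φ L Lb := ⟨hΦ0, hΦb, hL, hexpL, hLb⟩
  obtain ⟨Lbar, hLbar, hLbarL⟩ := exists_gateExtension D hflat' (by linarith) Φ L hΦ0 hL hexpL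
  have hGDL' := hGDL D ρ' Λ m b hAF' a r₀ m₀ hPR h2ρ' hDD hGP hGLB Φ L Lb hfr Lbar hLbar hLbarL
  ---------------------------------------------------------------- the trace on the small gate ball
  set c : ℂ := (((2 * Real.sqrt 3 : ℝ)) : ℂ) with hcdef
  have htrace : ∀ y' : ℂ, y'.im = (D.pt 1).im → y' ∈ ball (D.pt 1) (ρ' / 16) →
      Tendsto (fun z => g z * Complex.exp (-((5 / 8 : ℂ) * (L z - Lb)))) (𝓝[D.carrier] y') (𝓝 c) := by
    intro y' hy'im hy'b
    have key := eqOn_candidate_near_gate hAF' hPR h2ρ' hGP hL1' hfr hLbar hLbarL hGDL'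
      hns hg hweak hy'im hy'b
    have hev : (fun z => g z * Complex.exp (-((5 / 8 : ℂ) * (L z - Lb)))) =ᶠ[𝓝[D.carrier] y']
        fun _ => c := by
      filter_upwards [inter_mem_nhdsWithin D.carrier
        (isOpen_ball.mem_nhds (mem_ball_self (by positivity : (0 : ℝ) < ρ' / 64)))] with z hz
      rw [key hz]
      dsimp only
      rw [hLbarL hz.1, mul_assoc, ← Complex.exp_add, add_neg_cancel, Complex.exp_zero, mul_one]
    exact (tendsto_congr' hev).2 tendsto_const_nhds
  ---------------------------------------------------------------- spread over the carrier
  have hflat16 : D.carrier ∩ ball (D.pt 1) (ρ' / 16) =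
      {z : ℂ | (D.pt 1).im < z.im} ∩ ball (D.pt 1) (ρ' / 16) :=
    Engine.flat_of_subset hflat' rfl (ball_subset_ball (by linarith))
  have hid := Identification.identification_of_gateTrace_core D (ρ' / 16) Φ L Lb c g (by positivity)
    hflat16 hL hexpL hg htrace
  have hev : (fun z => g z * Complex.exp (-((5 / 8 : ℂ) * (L z - Lb)))) =ᶠ[𝓝[D.carrier] y]
      fun _ => c := by
    filter_upwards [self_mem_nhdsWithin] with z hz
    rw [hid z hz, mul_assoc, ← Complex.exp_add, add_neg_cancel, Complex.exp_zero, mul_one]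
  exact (tendsto_congr' hev).2 tendsto_const_nhds

end Summit.CriticalPhenomena.SAWScalingLimit.Theorems.PolygonParitySqueeze

end
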